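import Summits.AtomisticToContinuum.HydrodynamicLimit.Theorems.AntiMazurCoboundariesKineticFluxLdDecayWindowMonotone
import Summits.AtomisticToContinuum.HydrodynamicLimit.Theses.FluxGibbsianityLdDrude
import Summits.AtomisticToContinuum.HydrodynamicLimit.Theorems.JParityClosureOddContactSymmetryGibbsInvariance
import Literature.MathematicalPhysics.KineticTheory.HardSphereTwoTimePressure
import Literature.MathematicalPhysics.KineticTheory.HardSphereEulerProofs

/-!
# Line `meso-window-split` — crux `KineticFluxLdDecay` (stmt-AtomisticToContinuum-10967) — lead c3 FINAL skeleton (LINE-DEAD)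

Final state of the registered skeleton of the line (lead c3, 2026-08-17). The frame and the verbatim stub statements live in the
landed objects module `…Theorems.AntiMazurCoboundariesKineticFluxLdDecayMesoObjects` (p128962); the monotone bridge
`stub_windowMonotone : WindowMonotone` is LANDED (`…Theorems.AntiMazurCoboundariesKineticFluxLdDecayWindowMonotone`, p130489);
the exact factorisation `stub_mesoFactorization : KineticFluxLdDecay ↔ (MesoDecay ∧ MesoLocality)` is LANDED
(`…Theorems.AntiMazurCoboundariesKineticFluxLdDecayMesoFactorization`, p134143). The three remaining `sorry`s are the three
remaining registered stubs, with their verdicts: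

* `stub_mesoDecay : MesoDecay` — crux-sized (the horizon cap `τ ≤ δ(M+1)^γ` is load-bearing; uncapped it follows at each fixed `M`
  from Simányi's ergodicity + Birkhoff + equivalence of ensembles + Gibbs-tilt unprofitability; capped it is an `N`-uniform RATE =
  the crux's open content);
* `stub_lightConeMeso : LightConeMeso` — STUB-FALSE on paper for every exponent `γ ∈ (0, 1/4)` (exponential moments of the
  bad-forecast COUNT at fixed `lam` fail once `T/t_mf → ∞`: static near-contact rows + butterfly sleeves, transposed steered dispersal
  cascades of the sibling crux 13916; `Lines/meso_window_split_dead.md` §2) — it will never be discharged;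
* `stub_localityTransfer : LightConeMeso → MesoLocality` — vacuous given the above; its content `MesoLocality` is implied by the crux
  (`mesoLocality_of_crux`, landed) and has no proof route avoiding a count-currency light cone (dead.md §4).

Hence the line is DEAD (`Lines/meso_window_split_dead.md`); what survives is the factorisation `crux ⟺ MesoDecay ∧ MesoLocality`.
The composition below is kept so that the skeleton still concludes both route copies of the crux BY NAME from the registered stubs.
-/

noncomputable section

open MeasureTheory Set Filter
open scoped ENNReal Classical

namespace Summit.AtomisticToContinuum.HydrodynamicLimit.Cruxes.KineticFluxLdDecay.MesoWindowSplit

open Summit.AtomisticToContinuum.HydrodynamicLimit.Theorems.MesoWindowSplit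
open Summit.AtomisticToContinuum.HydrodynamicLimit.Theses.AntiMazurCoboundaries (KineticFluxLdDecay)
open Literature.MathematicalPhysics.KineticTheory (T3 V3 hsDiameter localGibbsLaw)
open Literature.Analysis.FluidPDE (HardSphereFlow Config localClusterState)

/-! ## Registered stubs still open (statements in the objects module) -/

/-- STUB 2 (size XL; OPEN — the HARDEST, the dynamical bet; crux-sized, see the module docstring). -/
theorem stub_mesoDecay : MesoDecay := by
  sorry

/-- STUB 3 (FALSE on paper for every `γ ∈ (0,1/4)` — `Lines/meso_window_split_dead.md` §2; kept only because it is registered). -/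
theorem stub_lightConeMeso : LightConeMeso := by
  sorry

/-- STUB 4 (vacuous given `¬ LightConeMeso`; content = `MesoLocality`, no proof route — dead.md §4). -/
theorem stub_localityTransfer : LocalityTransfer := by
  sorry

/-! ## Composition (sorry-free; the bridge and the factorisation are the LANDED theorems) -/

/-- Local copy of the LANDED composition `crux_of_mesoDecay_of_mesoLocality` (module …MesoFactorization, p134143 — not yet
built on the farm when this workfile was published; the skeleton must elaborate): mesoscopic decay + locality give the crux. -/
private theorem crux_of_parts' (hmeso : MesoDecay) (hloc : MesoLocality) :
    ∀ (a θ : ℝ) (u₀ : V3), 0 < a → 0 < θ → ∃ σ₀ : ℝ, 0 < σ₀ ∧ ∀ σ : ℝ, 0 < σ → σ < σ₀ →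
      (∀ (N : ℕ) (Φ : Flow σ N), IsProbabilityMeasure (gibbs σ a θ u₀ N Φ)) ∧
      ∃ κ : ℝ, 0 < κ ∧ ∀ (φ : T3 → ℝ) (g : V3 → ℝ), Continuous φ → Continuous g →
        (∀ x, |φ x| ≤ 1) → (∀ v, |g v| ≤ κ) → Orthogonal g →
        ∀ δ : ℝ, 0 < δ → ∃ τ : ℝ, 0 < τ ∧ ∃ N₀ : ℕ, ∀ N : ℕ, N₀ ≤ N → ∀ Φ : Flow σ N,
          ldLHS σ a θ u₀ φ g (τ * scale N) N Φ ≤ ENNReal.ofReal (Real.exp (δ * (N + 1))) := by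
  intro a θ u₀ ha hθ
  obtain ⟨σ₁, hσ₁, H₁⟩ := hmeso a θ u₀ ha hθ
  obtain ⟨σ₂, hσ₂, H₂⟩ := hloc a θ u₀ ha hθ
  refine ⟨min (min σ₁ σ₂) (1 / 2), lt_min (lt_min hσ₁ hσ₂) (by norm_num), fun σ hσ hσlt => ?_⟩
  have hσ₁' : σ < σ₁ := lt_of_lt_of_le hσlt ((min_le_left _ _).trans (min_le_left _ _))
  have hσ₂' : σ < σ₂ := lt_of_lt_of_le hσlt ((min_le_left _ _).trans (min_le_right _ _))
  have hσhalf : σ ≤ 1 / 2 := (lt_of_lt_of_le hσlt (min_le_right _ _)).le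
  have hP : ∀ (N : ℕ) (Φ : Flow σ N), IsProbabilityMeasure (gibbs σ a θ u₀ N Φ) := fun N Φ =>
    Literature.MathematicalPhysics.KineticTheory.isProbabilityMeasure_localGibbsLaw
      continuous_const continuous_const continuous_const (fun _ => ha) (fun _ => hθ) hσhalf N Φ
  refine ⟨hP, ?_⟩
  obtain ⟨κ₁, hκ₁, G₁⟩ := H₁ σ hσ hσ₁'
  obtain ⟨γ₀, hγ₀, C, hC, κ₂, hκ₂, G₂⟩ := H₂ σ hσ hσ₂'
  have hCpos : 0 < C := one_pos.trans_le hC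
  refine ⟨min (κ₁ / C) κ₂, lt_min (div_pos hκ₁ hCpos) hκ₂, fun φ g hφ hg hφ1 hgκ horth δ hδ => ?_⟩
  -- the inflated observable `C·g` is admissible for `MesoDecay`
  have hgC : ∀ v, |C * g v| ≤ κ₁ := fun v => by
    rw [abs_mul, abs_of_pos hCpos]
    calc C * |g v| ≤ C * (κ₁ / C) :=
          mul_le_mul_of_nonneg_left ((hgκ v).trans (min_le_left _ _)) hCpos.le
      _ = κ₁ := mul_div_cancel₀ κ₁ hCpos.ne'
  have hg₂ : ∀ v, |g v| ≤ κ₂ := fun v => (hgκ v).trans (min_le_right _ _)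
  have hgCcont : Continuous fun v => C * g v := continuous_const.mul hg
  have horthC : Orthogonal fun v => C * g v := fun c₀ c₂ b => by
    have h0 := horth c₀ c₂ b
    simp_rw [mul_assoc]
    rw [integral_const_mul, h0, mul_zero]
  -- tolerances
  set δ₁ : ℝ := min δ 1 / (κ₁ + 2) with hδ₁def
  have hk2 : 0 < κ₁ + 2 := by linarith
  have hδ₁ : 0 < δ₁ := div_pos (lt_min hδ one_pos) hk2
  have hδ₁le : δ₁ ≤ 1 := by
    rw [hδ₁def, div_le_one hk2]
    exact (min_le_right _ _).trans (by linarith)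
  -- mesoscopic decay for `C·g`, locality for `g`, both at exponent `γ₀` and tolerance `δ₁`
  obtain ⟨N₁, K₁⟩ := G₁ φ (fun v => C * g v) hφ hgCcont hφ1 hgC horthC γ₀ hγ₀ δ₁ hδ₁
  obtain ⟨N₂, K₂⟩ := G₂ φ g hφ hg hφ1 hg₂ horth γ₀ hγ₀ le_rfl δ₁ hδ₁
  set M : ℕ := max N₁ N₂ with hMdef
  obtain ⟨τ₁, hτ₁, hτ₁le, Hτ₁⟩ := K₁ M (le_max_left _ _)
  have hscale : 0 < scale M := Real.rpow_pos_of_pos (by positivity) _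
  have hhor : 0 < horizon γ₀ M := Real.rpow_pos_of_pos (by positivity) _
  obtain ⟨-, -, hmeas, hbdd⟩ := stub_mesoObjects
  -- the monotone bridge lifts the bound from Meso's horizon `τ₁` to the reference horizon `τ_M`
  have hA : ∀ Φ' : Flow σ M, ldLHS σ a θ u₀ φ (fun v => C * g v) (horizon γ₀ M * scale M) M Φ'
      ≤ ENNReal.ofReal (Real.exp ((δ₁ * (1 + κ₁)) * (M + 1))) := by
    intro Φ'
    haveI := hP M Φ'
    have hinv : ∀ t, MeasurePreserving (Φ'.flow t) (gibbs σ a θ u₀ M Φ') (gibbs σ a θ u₀ M Φ') :=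
      fun t => Summit.AtomisticToContinuum.HydrodynamicLimit.Theorems.measurePreserving_flow_localGibbsLaw_const
        σ a θ u₀ M Φ' t
    have hgood : ∀ᵐ z ∂(gibbs σ a θ u₀ M Φ'), z ∈ Φ'.good :=
      Literature.MathematicalPhysics.KineticTheory.ae_mem_good_localGibbsLaw σ _ _ _ M Φ'
    have hFm : Measurable (fluxObs θ u₀ φ (fun v => C * g v) M) := hmeas θ u₀ φ _ hφ hgCcont M
    have hFb : ∀ z, |fluxObs θ u₀ φ (fun v => C * g v) M z| ≤ (M + 1) * κ₁ := hbdd θ κ₁ u₀ φ _ hφ1 hgC M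
    have hle : τ₁ * scale M ≤ horizon γ₀ M * scale M :=
      mul_le_mul_of_nonneg_right (hτ₁le.trans (mul_le_of_le_one_left hhor.le hδ₁le)) hscale.le
    have hApos : 0 ≤ δ₁ * (M + 1) := by positivity
    have key := stub_windowMonotone (hsDiameter σ M) M Φ' (gibbs σ a θ u₀ M Φ') (hP M Φ') hinv hgood
      (fluxObs θ u₀ φ (fun v => C * g v) M) ((M + 1) * κ₁) hFm hFb (τ₁ * scale M)
      (horizon γ₀ M * scale M) (δ₁ * (M + 1)) (mul_pos hτ₁ hscale) hle hApos (Hτ₁ Φ')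
    refine key.trans (ENNReal.ofReal_le_ofReal (Real.exp_le_exp.2 ?_))
    have hratio : τ₁ * scale M / (horizon γ₀ M * scale M) ≤ δ₁ := by
      rw [mul_div_mul_right _ _ hscale.ne', div_le_iff₀ hhor]
      exact hτ₁le
    have hM1 : (0 : ℝ) ≤ (M + 1) * κ₁ := by positivity
    nlinarith [mul_le_mul_of_nonneg_right hratio hM1]
  obtain ⟨N₃, K₃⟩ := K₂ M (le_max_right _ _) (δ₁ * (1 + κ₁)) (by positivity) hA
  refine ⟨horizon γ₀ M, hhor, N₃, fun N hN Φ => ?_⟩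
  refine (K₃ N hN Φ).trans (ENNReal.ofReal_le_ofReal (Real.exp_le_exp.2 ?_))
  have hN1 : (0 : ℝ) ≤ (N : ℝ) + 1 := by positivity
  have h2 : δ₁ * (1 + κ₁) + δ₁ = min δ 1 := by
    rw [hδ₁def]
    field_simp
    ring
  have h3 : δ₁ * (1 + κ₁) + δ₁ ≤ δ := by linarith [min_le_left δ 1]
  exact mul_le_mul_of_nonneg_right h3 hN1


/-- **The skeleton concludes the crux BY NAME** (route `AntiMazurCoboundaries`, stmt-AtomisticToContinuum-10967) from the three
remaining registered stubs (closed only by their `sorry`s). -/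
theorem KineticFluxLdDecay_of : KineticFluxLdDecay :=
  crux_of_parts' stub_mesoDecay (stub_localityTransfer stub_lightConeMeso)

/-- The two routes' copies of the shared crux are the same term. -/
theorem kineticFluxLdDecay_routes_eq :
    Summit.AtomisticToContinuum.HydrodynamicLimit.Theses.FluxGibbsianityLdDrude.KineticFluxLdDecay = KineticFluxLdDecay :=
  rfl

/-- The skeleton also concludes the `FluxGibbsianityLdDrude` copy of the crux BY NAME (same three stubs). -/
theorem KineticFluxLdDecay_of' :
    Summit.AtomisticToContinuum.HydrodynamicLimit.Theses.FluxGibbsianityLdDrude.KineticFluxLdDecay :=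
  crux_of_parts' stub_mesoDecay (stub_localityTransfer stub_lightConeMeso)

end Summit.AtomisticToContinuum.HydrodynamicLimit.Cruxes.KineticFluxLdDecay.MesoWindowSplit

end
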